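import Literature.NumberTheory.EllipticCurves.GreenbergVatsal2000.CharacterLambdaCertificateZeroProofs
import Literature.NumberTheory.EllipticCurves.GreenbergVatsal2000.CharacterPAdicLFunctionUniquenessProofs
import Literature.NumberTheory.EllipticCurves.GreenbergVatsal2000.CharacterLValueCEulerFactorProofs
import Literature.NumberTheory.EllipticCurves.GreenbergVatsal2000.CharacterPAdicLFunctionExistenceProofs
import Literature.NumberTheory.EllipticCurves.KubotaLeopoldtIwasawaFunctionProofs
import Summits.BirchSwinnertonDyer.Rank1Residual.X2.EulerFactorInvariants
import HarnessLib

/-!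
# Crux 3 `MazurMCOnCellB` (stmt-BirchSwinnertonDyer-19033), line `twistback` — KERNEL F1, part A:
# the `Σ₀`-depletion of Greenberg–Vatsal's CHARACTER `p`-adic `L`-functions `L_{Σ₀}(C,T)`, `L_{Σ₀}(D,T)`
# as an identity IN `Λ`, and their `λ`/`μ`-invariants from ONE Bernoulli number (the «KL-flat» certificate)

LEAD bsd-line-x2-p1 g10 (2026-08-28). HONEST FRAMING (cell `bsd-eis`, run/shared/lean/pub/bsd-eis/): theorems
only (no `def`, no named fact, no `sorry`); curve-free statements about Dirichlet characters and elements of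
`Λ = ℤ_p⟦T⟧`; nothing about any elliptic curve, no main conjecture, no BSD; 0 cells / labels move. This is the
character half of LEAD g9's «Kernel F1» (`Cruxes/MazurMCOnCellB/Lines/twistback-lead-verdict-g9.md` §4/§4′,
validated 51/51 on the census): Greenberg–Vatsal's λ-formula `λ_an(E) + Σ_ℓ δ_E^{(ℓ)} = λ(L_{Σ₀}(C)) +
λ(L_{Σ₀}(D))` needs, to be USED class-wide, the character-side bookkeeping
`λ(L_{Σ₀}(X,T)) = λ(L_∅(X,T)) + Σ_{ℓ∈Σ₀} δ^X_ℓ` (`X ∈ {C, D}`) and a certificate for `λ(L_∅(X,T))`.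

* §1 `natCast_eq_teichmullerLift_mul_cycPow` — `ℓ = ω(ℓ)·γ^{f_ℓ}` in `ℤ_p` with GV's Frobenius exponent
  `f_ℓ = frobeniusExponent p ℓ` (`⟨ℓ⟩ = γ^{f_ℓ}`).
* §2 `hasUnitContent_and_order_one_sub_C_mul_binomialSeries` — the Euler-type element `1 − a(1+T)^f ∈ Λ`
  (`f ≠ 0`) has `μ = 0` and `ord_T(· mod p) = p^{v_p(f)}·[a ≡ 1 (mod p)]`.
* §3 the CHARACTER Euler elements and their values (GV p. 42): `e^C_ℓ = 1 − ω(φ(ℓ)ℓ̄⁻¹)(1+T)^{f_ℓ}` takes the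
  value `1 − (φω^{−k})(ℓ)ℓ^{k−1}` at `T = κ(γ)^{k−1} − 1`; `e^D_ℓ = 1 − ω(ψ(ℓ))ℓ⁻¹(1+T)^{f_ℓ}` takes the value
  `1 − ψ(ℓ)ω(ℓ)^{k−1}ℓ^{−k}` at `T = κ(γ)^{1−k} − 1`; both have `ord_T(· mod p) = s_ℓ·[θ(ℓ) ≡ ℓ (mod p)]`
  (`θ = φ`, resp. `ψ`; `s_ℓ = GreenbergVatsal2000.sFactor p ℓ`).
* §4 **depletion in `Λ`**: ANY `L_{Σ₀}(C,T)` is `L_∅(C,T)·∏_{ℓ∈Σ₀} e^C_ℓ` and ANY `L_{Σ₀}(D,T)` is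
  `L_∅(D,T)·∏_{ℓ∈Σ₀} e^D_ℓ` (the products have the `Σ₀`-interpolation property — multiplicativity of
  evaluation, `characterLValueC_eq_prod_eulerFactor_mul` / the definition of `characterLValueD` — and GV p. 41/42:
  the interpolation property CHARACTERIZES the function, `IsCharacterLFunctionC/D.unique`).
Sequel (`EisensteinPrimesCharacterLambdaBookkeeping.lean`): `λ(L_{Σ₀}(X)) = λ(L_∅(X)) + Σ_ℓ s_ℓ[θ(ℓ) ≡ ℓ]` and
the KL-flat certificate (`L_∅(X, 0)` a unit ⟹ `λ(L_{Σ₀}(X)) = Σ_ℓ s_ℓ[θ(ℓ) ≡ ℓ]`, `μ = 0`).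

References: [GreenbergVatsal2000] §1 p. 9, §2 Prop. (2.4) p. 22, §3 pp. 41–42 ((26)–(28)); [LangCyclotomic1990]
Ch. 4 §1 Thm. 1.2, §3 Thm. 3.2, Ch. 5 §2 Thm. 2.2; [Greenberg2001PastPresent] §4 pp. 355–356;
[Washington1997] §7.1.
-/

set_option autoImplicit false

-- `Summit.BirchSwinnertonDyer.BirchSwinnertonDyer.…`: the summit and its single sub-problem share a name.
set_option linter.dupNamespace false

noncomputable section

open scoped Classical

open NumberField IsDedekindDomain PowerSeries Literature.NumberTheory.EllipticCurves
  Literature.NumberTheory.EllipticCurves.CyclotomicZp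
  Literature.NumberTheory.EllipticCurves.GreenbergVatsal2000
  Summit.BirchSwinnertonDyer.Rank1Residual.X2.EulerFactorAlgebra
  Summit.BirchSwinnertonDyer.Rank1Residual.X2.EulerFactorInvariants

namespace Summit.BirchSwinnertonDyer.BirchSwinnertonDyer.Theorems.EisensteinPrimesCharacterEulerDepletion

variable {p : ℕ} [hp : Fact p.Prime]

/-! ## §1. `ℓ = ω(ℓ) · γ^{f_ℓ}` with GV's Frobenius exponent -/

/-- **`ℓ = ω(ℓ̄)·κ(γ)^{f_ℓ}` in `ℤ_p`** for an integer `ℓ` prime to the odd prime `p`: the Teichmüller part of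
the unit `ℓ` is the Teichmüller lift of its residue, and its `1`-unit part `⟨ℓ⟩` is `γ^{f_ℓ}` with
`f_ℓ = GreenbergVatsal2000.frobeniusExponent p ℓ` (GV p. 9: "`f_ℓ ∈ ℤ_p` is determined by `γ^{f_ℓ} = γ_ℓ`";
Lang Ch. 4 §3: `a = ω(a)⟨a⟩`). [cite: GreenbergVatsal2000, §1 p. 9 (definition of f_ℓ)]
[cite: LangCyclotomic1990, Ch. 4 §3 (⟨a⟩ and ω, PDF p. 84)] -/
theorem natCast_eq_teichmullerLift_mul_cycPow (hp2 : p ≠ 2) {ℓ : ℕ} (hℓ : p.Coprime ℓ) :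
    (ℓ : ℤ_[p]) = teichmullerLift p (ℓ : ZMod p) * cycPow p (frobeniusExponent p (ℓ : ℤ_[p])) := by
  have hu : IsUnit (ℓ : ℤ_[p]) := isUnit_natCast_of_coprime hℓ
  rw [frobeniusExponent_of_isUnit hu]
  set u : ℤ_[p]ˣ := hu.unit with hudef
  have huval : (u : ℤ_[p]) = ℓ := hu.unit_spec
  set e : ℤ_[p] := ell p u with he
  have hinv : cycPow p (-e) * cycPow p e = 1 := by
    rw [← AddChar.map_add_eq_mul, neg_add_cancel, AddChar.map_zero_eq_one]
  set ζu : ℤ_[p]ˣ := u * cycPowUnit p (-e) with hζu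
  have hζval : (ζu : ℤ_[p]) = (u : ℤ_[p]) * cycPow p (-e) := rfl
  have hζpow : ζu ^ torsionOrder p = 1 := by
    ext
    rw [Units.val_pow_eq_pow_val, hζval, mul_pow, Units.val_one, ← AddChar.map_nsmul_eq_pow,
      nsmul_eq_mul, mul_neg, ← cycPow_torsionOrder_mul_ell p u, ← he]
    have h2 : cycPow p (↑(torsionOrder p) * e) * cycPow p (-(↑(torsionOrder p) * e)) = 1 := by
      rw [← AddChar.map_add_eq_mul, add_neg_cancel, AddChar.map_zero_eq_one]
    exact h2
  have hteich : teichmullerLift p (PadicInt.toZMod ((ζu : ℤ_[p]))) = (ζu : ℤ_[p]) :=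
    teichmullerLift_toZMod_rootsOfUnity p hp2 ⟨ζu, (mem_rootsOfUnity _ _).mpr hζpow⟩
  have htoZ : PadicInt.toZMod ((ζu : ℤ_[p])) = (ℓ : ZMod p) := by
    rw [hζval, map_mul, toZMod_cycPow, mul_one, huval, map_natCast]
  calc (ℓ : ℤ_[p]) = (u : ℤ_[p]) := huval.symm
    _ = (ζu : ℤ_[p]) * cycPow p e := by rw [hζval, mul_assoc, hinv, mul_one]
    _ = teichmullerLift p (ℓ : ZMod p) * cycPow p e := by rw [← htoZ, hteich]


/-! ## §2. The Euler-type element `1 − a(1+T)^f ∈ Λ`: `μ = 0`, `ord_T = p^{v_p(f)}·[a ≡ 1]` -/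

/-- **`μ` and `λ` of `1 − a·(1+T)^f ∈ Λ`** (`a ∈ ℤ_p`, `0 ≠ f ∈ ℤ_p`): modulo `p` it is
`(1 − ā) − ā((1+T)^f − 1)`, a unit if `ā ≠ 1` and `−((1+T)^f − 1)` of `T`-order `p^{v_p(f)}` if `ā = 1`
(`EulerFactorAlgebra.order_map_binomialSeries_sub_one`); in particular it has unit content. This is the
shape of every `Σ₀`-Euler factor of GV pp. 8–9 and p. 42 (curve or character) and the source of the factor
`s_ℓ = p^{v_p(f_ℓ)}` in Prop. (2.4). [cite: GreenbergVatsal2000, §2 Prop. (2.4) (p. 22) and §3 p. 42]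
[cite: Washington1997, §7.1] -/
theorem hasUnitContent_and_order_one_sub_C_mul_binomialSeries (a f : ℤ_[p]) (hf : f ≠ 0) :
    HasUnitContent (1 - PowerSeries.C a * PowerSeries.binomialSeries ℤ_[p] f) ∧
      (PowerSeries.map (PadicInt.toZMod (p := p))
          (1 - PowerSeries.C a * PowerSeries.binomialSeries ℤ_[p] f)).order =
        if PadicInt.toZMod a = 1 then ((p ^ f.valuation : ℕ) : ℕ∞) else 0 := by
  set G := PowerSeries.map (PadicInt.toZMod (p := p)) (PowerSeries.binomialSeries ℤ_[p] f) with hG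
  have hmap : PowerSeries.map (PadicInt.toZMod (p := p))
      (1 - PowerSeries.C a * PowerSeries.binomialSeries ℤ_[p] f) =
        1 - PowerSeries.C (PadicInt.toZMod a) * G := by
    rw [map_sub, map_one, map_mul, PowerSeries.map_C]
  have hG0 : PowerSeries.constantCoeff G = 1 := by
    rw [hG, ← PowerSeries.coeff_zero_eq_constantCoeff_apply, PowerSeries.coeff_map,
      PowerSeries.binomialSeries_coeff, Ring.choose_zero_right, one_smul, map_one]
  have hord : (PowerSeries.map (PadicInt.toZMod (p := p))
      (1 - PowerSeries.C a * PowerSeries.binomialSeries ℤ_[p] f)).order =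
        if PadicInt.toZMod a = 1 then ((p ^ f.valuation : ℕ) : ℕ∞) else 0 := by
    rw [hmap]
    split_ifs with ha
    · rw [ha, map_one, one_mul, show (1 : PowerSeries (ZMod p)) - G = -(G - 1) by ring,
        PowerSeries.order_neg, hG, order_map_binomialSeries_sub_one p hf, Nat.cast_pow]
    · refine PowerSeries.order_zero_of_unit ?_
      rw [PowerSeries.isUnit_iff_constantCoeff, map_sub, map_one, map_mul, PowerSeries.constantCoeff_C,
        hG0, mul_one]
      exact isUnit_iff_ne_zero.mpr (sub_ne_zero.mpr (Ne.symm ha))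
  refine ⟨?_, hord⟩
  rw [hasUnitContent_iff_map_toZMod_ne_zero]
  intro h0
  rw [h0, PowerSeries.order_zero] at hord
  split_ifs at hord with ha
  · exact ENat.top_ne_coe _ hord
  · exact ENat.top_ne_zero hord

/-! ## §3. The character Euler elements `e^C_ℓ`, `e^D_ℓ` (GV p. 42) and their values and orders -/

section EulerElements

variable (p) {m d : ℕ} (φ : DirichletCharacter (ZMod p) m) (ψ : DirichletCharacter (ZMod p) d)

/-- **The `C`-side Euler element `e^C_ℓ = 1 − ω(φ(ℓ)·ℓ̄⁻¹)·(1+T)^{f_ℓ} ∈ Λ` interpolates GV's Euler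
factors of `L_{Σ₀}(C,T)`**: its value at `T = κ(γ)^{j} − 1` is `1 − (φω^{−(j+1)})(ℓ)·ℓ^{j}` — "the
`l`-th Euler factor `1 − χψ⁻¹ρ(l)` in `L(χψ⁻¹ρ, s)`" at `s = −j` (GV p. 42; `ψ⁻¹ω = φ`), i.e. the factor
of `characterLValueC_eq_prod_eulerFactor_mul` at `k = j + 1`. Proof: `ℓ = ω(ℓ̄)γ^{f_ℓ}` (§1) and
`ω(ℓ̄⁻¹)ω(ℓ̄) = 1`. [cite: GreenbergVatsal2000, §3 p. 42 (the Euler factors 1 − χψ⁻¹(l)(1+T)^{f_l} of L_{Σ₀}(C,χ,T))]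
[cite: LangCyclotomic1990, Ch. 4 §1 Thm. 1.2 and Examples 1–2 (PDF p. 79)] -/
theorem hasSum_eulerElementC (hp2 : p ≠ 2) {ℓ : ℕ} (hℓ : ℓ.Prime) (hℓp : ℓ ≠ p) (j : ℕ) :
    HasSum (fun n ↦ ((PowerSeries.coeff n
        (1 - PowerSeries.C (teichmullerLift p (φ (ℓ : ZMod m) * ((ℓ : ZMod p))⁻¹)) *
          PowerSeries.binomialSeries ℤ_[p] (frobeniusExponent p (ℓ : ℤ_[p]))) : ℤ_[p]) : ℚ_[p]) *
        (((cyclotomicGenerator p : ℕ) : ℚ_[p]) ^ j - 1) ^ n)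
      (1 - ((evenCharacterTwist p φ (j + 1) ℓ : ℤ_[p]) : ℚ_[p]) * ((ℓ : ℕ) : ℚ_[p]) ^ j) := by
  have pp : p.Prime := Fact.out
  have hpl : ¬ p ∣ ℓ := fun h ↦ hℓp ((Nat.prime_dvd_prime_iff_eq pp hℓ).mp h).symm
  have hcop : p.Coprime ℓ := (Nat.Prime.coprime_iff_not_dvd pp).mpr hpl
  set a : ℤ_[p] := teichmullerLift p (φ (ℓ : ZMod m) * ((ℓ : ZMod p))⁻¹) with ha
  set f : ℤ_[p] := frobeniusExponent p (ℓ : ℤ_[p]) with hfdef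
  have h := hasSum_intCoeff_one_sub_C_mul_binomialSeries p a (j : ℤ_[p]) f
  rw [coe_cycPow_natCast] at h
  convert h using 2
  -- the value: `(φω^{-(j+1)})(ℓ) ℓ^j = a γ^{j f_ℓ}`
  have hℓ0 : (ℓ : ZMod p) ≠ 0 := by
    rw [Ne, ZMod.natCast_eq_zero_iff]; exact hpl
  have hωinv : teichmullerLift p ((ℓ : ZMod p))⁻¹ * teichmullerLift p (ℓ : ZMod p) = 1 := by
    rw [← teichmullerLift_mul, inv_mul_cancel₀ hℓ0, teichmullerLift_one]
  have hZ : evenCharacterTwist p φ (j + 1) ℓ * (ℓ : ℤ_[p]) ^ j = a * cycPow p ((j : ℤ_[p]) * f) := by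
    rw [evenCharacterTwist, if_neg hpl, natCast_eq_teichmullerLift_mul_cycPow hp2 hcop, ← hfdef, mul_pow,
      ← AddChar.map_nsmul_eq_pow, nsmul_eq_mul, ha, teichmullerLift_mul, teichmullerLift_mul,
      teichmullerLift_pow, pow_succ]
    have : teichmullerLift p ((ℓ : ZMod p))⁻¹ ^ j * teichmullerLift p (ℓ : ZMod p) ^ j = 1 := by
      rw [← mul_pow, hωinv, one_pow]
    linear_combination (teichmullerLift p (φ (ℓ : ZMod m)) * teichmullerLift p ((ℓ : ZMod p))⁻¹ *
      cycPow p ((j : ℤ_[p]) * f)) * this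
  rw [← PadicInt.coe_natCast, ← PadicInt.coe_pow, ← PadicInt.coe_mul, hZ, PadicInt.coe_mul]

/-- **The `D`-side Euler element `e^D_ℓ = 1 − ω(ψ(ℓ))·ℓ⁻¹·(1+T)^{f_ℓ} ∈ Λ` interpolates GV's Euler factors
of `L_{Σ₀}(D,T)`**: its value at `T = κ(γ)^{−j} − 1` is `1 − ψ(ℓ)ω(ℓ)^{j}ℓ^{−(j+1)}` — "one multiplies by the
Euler factors `1 − χψ(l)l⁻¹(1 + T)^{f_l}` … The value at `T = ζ − 1` is the `l`-th Euler factor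
`1 − χψρ(l)l⁻¹`" (GV p. 42), i.e. the factor in the definition of `characterLValueD` at `k = j + 1` (the
tree's `exists_eulerFactorD`, here with the element made explicit: `ℓ⁻¹ = PadicInt.inv ℓ`, `f_ℓ =
frobeniusExponent p ℓ`). [cite: GreenbergVatsal2000, §3 p. 42 (the Euler factors 1 − χψ(l)l⁻¹(1+T)^{f_l} of L_{Σ₀}(D,χ,T))]
[cite: LangCyclotomic1990, Ch. 4 §1 Thm. 1.2 and Examples 1–2 (PDF p. 79)] -/
theorem hasSum_eulerElementD (hp2 : p ≠ 2) {ℓ : ℕ} (hℓ : ℓ.Prime) (hℓp : ℓ ≠ p) (j : ℕ) :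
    HasSum (fun n ↦ ((PowerSeries.coeff n
        (1 - PowerSeries.C (teichmullerLift p (ψ (ℓ : ZMod d)) * (ℓ : ℤ_[p]).inv) *
          PowerSeries.binomialSeries ℤ_[p] (frobeniusExponent p (ℓ : ℤ_[p]))) : ℤ_[p]) : ℚ_[p]) *
        ((((cyclotomicGenerator p : ℕ) : ℚ_[p])⁻¹) ^ j - 1) ^ n)
      (1 - ((teichmullerLift p (ψ (ℓ : ZMod d)) * teichmullerLift p (ℓ : ZMod p) ^ j : ℤ_[p]) : ℚ_[p]) *
        ((ℓ : ℚ_[p])⁻¹) ^ (j + 1)) := by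
  have pp : p.Prime := Fact.out
  have hpl : ¬ p ∣ ℓ := fun h ↦ hℓp ((Nat.prime_dvd_prime_iff_eq pp hℓ).mp h).symm
  have hcop : p.Coprime ℓ := (Nat.Prime.coprime_iff_not_dvd pp).mpr hpl
  have hnorm : ‖(ℓ : ℤ_[p])‖ = 1 := PadicInt.norm_natCast_eq_one_iff.mpr hcop
  set a : ℤ_[p] := teichmullerLift p (ψ (ℓ : ZMod d)) * (ℓ : ℤ_[p]).inv with ha
  set f : ℤ_[p] := frobeniusExponent p (ℓ : ℤ_[p]) with hfdef
  set ζ : ℤ_[p] := teichmullerLift p (ℓ : ZMod p) with hζ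
  have h := hasSum_intCoeff_one_sub_C_mul_binomialSeries p a (-(j : ℤ_[p])) f
  rw [coe_cycPow_neg_natCast] at h
  convert h using 2
  -- the value: `ψ(ℓ) ω(ℓ)^j ℓ^{-(j+1)} = a γ^{-j f_ℓ}`
  have hℓ0 : (ℓ : ℚ_[p]) ≠ 0 := by exact_mod_cast hℓ.ne_zero
  have hζ0 : ((ζ : ℤ_[p]) : ℚ_[p]) ≠ 0 := by
    rw [hζ, ne_eq, PadicInt.coe_eq_zero, teichmullerLift_of_ne_zero]
    · exact Units.ne_zero _
    · rw [Ne, ZMod.natCast_eq_zero_iff]; exact hpl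
  have hinv : (((ℓ : ℤ_[p]).inv : ℤ_[p]) : ℚ_[p]) = (ℓ : ℚ_[p])⁻¹ := by
    refine eq_inv_of_mul_eq_one_right ?_
    rw [← PadicInt.coe_natCast, ← PadicInt.coe_mul, PadicInt.mul_inv hnorm, PadicInt.coe_one]
  have hcyc : ((cycPow p f : ℤ_[p]) : ℚ_[p]) = (ℓ : ℚ_[p]) * (((ζ : ℤ_[p]) : ℚ_[p]))⁻¹ := by
    rw [eq_mul_inv_iff_mul_eq₀ hζ0, mul_comm, ← PadicInt.coe_mul, hζ, hfdef,
      ← natCast_eq_teichmullerLift_mul_cycPow hp2 hcop, PadicInt.coe_natCast]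
  have hneg : ((cycPow p (-(j : ℤ_[p]) * f) : ℤ_[p]) : ℚ_[p]) =
      (((cycPow p f : ℤ_[p]) : ℚ_[p]) ^ j)⁻¹ := by
    refine eq_inv_of_mul_eq_one_left ?_
    rw [← PadicInt.coe_pow, ← PadicInt.coe_mul, ← AddChar.map_nsmul_eq_pow, nsmul_eq_mul,
      ← AddChar.map_add_eq_mul, neg_mul, neg_add_cancel, AddChar.map_zero_eq_one, PadicInt.coe_one]
  rw [hneg, hcyc, ha]
  push_cast
  rw [hinv]
  simp only [mul_pow, mul_inv, inv_inv, inv_pow]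
  ring

end EulerElements

/-! ## §4. Depletion IN `Λ`: `L_{Σ₀}(X,T) = L_∅(X,T) · ∏_{ℓ∈Σ₀} e^X_ℓ` (`X = C, D`) -/

section Depletion

variable (p) {m d : ℕ} (φ : DirichletCharacter (ZMod p) m) (ψ : DirichletCharacter (ZMod p) d)
  (S₀ : Finset (HeightOneSpectrum (𝓞 ℚ)))

/-- **`L_{Σ₀}(C,T) = L_∅(C,T) · ∏_{ℓ∈Σ₀} e^C_ℓ` in `Λ`** (`p` odd, `m ≥ 1`, no place of `Σ₀` above `p`): the
right-hand side has the `Σ₀`-interpolation property (multiplicativity of evaluation on the open unit disc,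
Lang Ch. 4 Thm. 1.2, with §3 and `characterLValueC_eq_prod_eulerFactor_mul` = GV p. 42 "To obtain the
nonprimitive `p`-adic `L`-function `L_{Σ₀}(C, χ, T)`, one multiplies `L(C, χ, T)` by the `l`-th Euler
factors"), and the interpolation property characterizes `L_{Σ₀}(C,T)` (GV p. 41; `IsCharacterLFunctionC.unique`).
Valid for ANY elements with the two predicates. [cite: GreenbergVatsal2000, §3 pp. 41–42 ((26); Σ₀-depletion; "characterized by the interpolation property")]
[cite: LangCyclotomic1990, Ch. 4 §1 Thm. 1.2 (PDF p. 79) and Ch. 5 §2 Thm. 2.2 (PDF p. 97)] -/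
theorem charFunctionC_eq_mul_prod [NeZero m] (hp2 : p ≠ 2)
    (hS : ∀ v ∈ S₀, ((p : ℕ) : 𝓞 ℚ) ∉ v.asIdeal) {gS g₀ : IwasawaAlgebra p}
    (hgS : IsCharacterLFunctionC p φ S₀ gS) (hg₀ : IsCharacterLFunctionC p φ ∅ g₀) :
    gS = g₀ * ∏ v ∈ S₀, (1 - PowerSeries.C (teichmullerLift p
        (φ (Rat.HeightOneSpectrum.natGenerator v : ZMod m) *
          ((Rat.HeightOneSpectrum.natGenerator v : ZMod p))⁻¹)) *
        PowerSeries.binomialSeries ℤ_[p]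
          (frobeniusExponent p (Rat.HeightOneSpectrum.natGenerator v : ℤ_[p]))) := by
  refine IsCharacterLFunctionC.unique φ S₀ hgS fun k hk ↦ ?_
  obtain ⟨j, rfl⟩ : ∃ j, k = j + 1 := ⟨k - 1, by omega⟩
  have hm : 0 < m := Nat.pos_of_ne_zero (NeZero.ne m)
  have hz : ‖((cyclotomicGenerator p : ℕ) : ℚ_[p]) ^ j - 1‖ < 1 := norm_cyclotomicGenerator_pow_sub_one_lt j
  have hg₀' := hg₀ (j + 1) hk
  simp only [Nat.add_sub_cancel] at hg₀' ⊢
  have hprod := hasSum_intCoeff_prod_mul_pow p S₀ _ _ hz fun v hv ↦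
    hasSum_eulerElementC p φ hp2 (Rat.HeightOneSpectrum.prime_natGenerator v)
      (natGenerator_ne_of_natCast_not_mem v (hS v hv)) j
  have h := hasSum_intCoeff_mul_mul_pow hz hg₀' hprod
  convert h using 1
  rw [characterLValueC_eq_prod_eulerFactor_mul p φ S₀ hk hm,
    characterLValueC_eq_prod_eulerFactor_mul p φ ∅ hk hm, Finset.prod_empty, one_mul,
    Nat.add_sub_cancel, mul_comm]

/-- **`L_{Σ₀}(D,T) = L_∅(D,T) · ∏_{ℓ∈Σ₀} e^D_ℓ` in `Λ`** (`p` odd, no place of `Σ₀` above `p`): the right-hand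
side has the `Σ₀`-interpolation property (§3 with the Euler factors in the definition of `characterLValueD` =
GV p. 42 "To obtain `L_{Σ₀}(D, χ, T)`, one multiplies by the Euler factors `1 − χψ(l)l⁻¹(1 + T)^{f_l}`"), and
the interpolation property characterizes `L_{Σ₀}(D,T)` (GV p. 42; `IsCharacterLFunctionD.unique`). Valid for
ANY elements with the two predicates. [cite: GreenbergVatsal2000, §3 p. 42 ((27); Σ₀-depletion; "characterized by the interpolation property")]
[cite: LangCyclotomic1990, Ch. 4 §1 Thm. 1.2 (PDF p. 79) and Ch. 5 §2 Thm. 2.2 (PDF p. 97)] -/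
theorem charFunctionD_eq_mul_prod (hp2 : p ≠ 2)
    (hS : ∀ v ∈ S₀, ((p : ℕ) : 𝓞 ℚ) ∉ v.asIdeal) {gS g₀ : IwasawaAlgebra p}
    (hgS : IsCharacterLFunctionD p ψ S₀ gS) (hg₀ : IsCharacterLFunctionD p ψ ∅ g₀) :
    gS = g₀ * ∏ v ∈ S₀, (1 - PowerSeries.C (teichmullerLift p
        (ψ (Rat.HeightOneSpectrum.natGenerator v : ZMod d)) *
          (Rat.HeightOneSpectrum.natGenerator v : ℤ_[p]).inv) *
        PowerSeries.binomialSeries ℤ_[p]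
          (frobeniusExponent p (Rat.HeightOneSpectrum.natGenerator v : ℤ_[p]))) := by
  refine IsCharacterLFunctionD.unique ψ S₀ hgS fun k hk ↦ ?_
  obtain ⟨j, rfl⟩ : ∃ j, k = j + 1 := ⟨k - 1, by omega⟩
  have hz : ‖(((cyclotomicGenerator p : ℕ) : ℚ_[p])⁻¹) ^ j - 1‖ < 1 :=
    norm_cyclotomicGenerator_inv_pow_sub_one_lt j
  have hg₀' := hg₀ (j + 1) hk
  simp only [Nat.add_sub_cancel] at hg₀' ⊢
  have hprod := hasSum_intCoeff_prod_mul_pow p S₀ _ _ hz fun v hv ↦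
    hasSum_eulerElementD p ψ hp2 (Rat.HeightOneSpectrum.prime_natGenerator v)
      (natGenerator_ne_of_natCast_not_mem v (hS v hv)) j
  have h := hasSum_intCoeff_mul_mul_pow hz hg₀' hprod
  convert h using 1
  unfold characterLValueD
  rw [Finset.prod_empty, mul_one, Nat.add_sub_cancel]

end Depletion

end Summit.BirchSwinnertonDyer.BirchSwinnertonDyer.Theorems.EisensteinPrimesCharacterEulerDepletion

end
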